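import Summits.Ventures.Crystal3D.Theorems.StickyWulffConstantCoaxialWallLawTwoSidedSlots
import Summits.Ventures.Crystal3D.Theorems.StickyWulffConstantCoaxialWallLawOffSite
import HarnessLib

/-!
# The two-sided off-site budget law of `stub_coaxialTwoSlabAdhesion`: both grains' rows charged, constant `2√6/3`

HONEST FRAMING. Part of the venture `Summits/Ventures/Crystal3D` (cell `crystal3d-full`), helper
`--supports` the crux `CoaxialWallLaw` (stmt-Ventures-19481, `route-Ventures-StickyWulffConstant`),
REGISTERED line `WallLedgerF` (planner cf-p1 gen 16), open stub `stub_coaxialTwoSlabAdhesion`.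
RUNG CREDIT ONLY; F-C1 not moved.  `…CoaxialWallLawOffSite.coaxialTwoSlabAdhesion_offSite` charges only the
in-plane rows of the BOTTOM grain (constant `√6/3`); the rows of the TOP grain rooted in the top sample end at
the risers as well (`…InPlaneRunEndsTop`, `…TwoSidedSlots`), along the OPPOSITE signed classes `−d₁, −d₂, −d₃`,
and the six signed classes are distinct vacant-site directions of the local law — so the charge doubles:

* **`coaxialTwoSlabAdhesion_offSite_twoSided`** — frame data `(L, s₁, s₂, σ, σ')`, `Λ₁ ≠ Λ₂`, and COMPATIBLE
  origins (`s₂ − s₁` a site vector — otherwise no ball of `Λ₂` is a site of `(L, s₁)` and the top rows are not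
  on-site; the one-sided law still applies): for every filling,
  `cross ≤ D(Y) + (φ₁ + φ₂ − (2√6/3)·sin θ) πρ² + C(1+h)ρ + ½·B`, `B` as in `…OffSite` (off-site contacts of
  on-site riser balls in the window).  `2√6/3 ≈ 1.633`: within a factor `1.5` of the rigid-site truth `√6` at
  `{112}` (cell's F⁻ census).

WHAT THIS IS NOT: no bound on `B`; F-C1 not moved.
-/

noncomputable section

namespace Summit.Ventures.Crystal3D.Theorems

open Summit.Ventures.Crystal3D Finset
open Literature.MathematicalPhysics.StatisticalMechanics (fccStacking barlowStacking IsHaggSeq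
  contactDeficiency triangularVec₁ triangularVec₂ barlowOffset layerNormal)
open scoped InnerProductSpace

open scoped Classical in
/-- **The TWO-SIDED off-site budget law of `stub_coaxialTwoSlabAdhesion`** (ARBITRARY fillings, constant `2√6/3`,
explicit frame): both grains' in-plane rows are charged.  See the module docstring. -/
theorem coaxialTwoSlabAdhesion_offSite_twoSided
    (A₁ : EuclideanSpace ℝ (Fin 3) ≃ₗᵢ[ℝ] EuclideanSpace ℝ (Fin 3)) (t₁ : EuclideanSpace ℝ (Fin 3))
    (A₂ : EuclideanSpace ℝ (Fin 3) ≃ₗᵢ[ℝ] EuclideanSpace ℝ (Fin 3)) (t₂ : EuclideanSpace ℝ (Fin 3))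
    (L : EuclideanSpace ℝ (Fin 3) ≃ₗᵢ[ℝ] EuclideanSpace ℝ (Fin 3)) (s₁ s₂ : EuclideanSpace ℝ (Fin 3))
    {σ σ' : ℤ → ℤ} (hσ : IsHaggSeq σ) (hσ' : IsHaggSeq σ')
    (hsub₁ : (fun p => A₁ p + t₁) '' fccStacking 1 (Real.sqrt (2 / 3)) ⊆
      (fun p => L p + s₁) '' barlowStacking 1 (Real.sqrt (2 / 3)) σ)
    (hsub₂ : (fun p => A₂ p + t₂) '' fccStacking 1 (Real.sqrt (2 / 3)) ⊆
      (fun p => L p + s₂) '' barlowStacking 1 (Real.sqrt (2 / 3)) σ')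
    (hne : (fun p => A₁ p + t₁) '' fccStacking 1 (Real.sqrt (2 / 3)) ≠
      (fun p => A₂ p + t₂) '' fccStacking 1 (Real.sqrt (2 / 3)))
    (hcompat : ∃ i j c k : ℤ, s₂ = L ((i : ℝ) • triangularVec₁ (1 : ℝ) + (j : ℝ) • triangularVec₂ (1 : ℝ) +
      (c : ℝ) • barlowOffset (1 : ℝ) + (k : ℝ) • layerNormal (Real.sqrt (2 / 3))) + s₁) :
    ∃ C R₀ : ℝ, 1 ≤ R₀ ∧ ∀ h : ℝ, 0 ≤ h → ∀ ρ : ℝ, R₀ ≤ ρ →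
      ∀ X P₁ P₂ : Finset (EuclideanSpace ℝ (Fin 3)),
      (∀ p ∈ X, ∀ q ∈ X, p ≠ q → 1 ≤ dist p q) → P₁ ⊆ X → P₂ ⊆ X \ P₁ →
      (∀ p ∈ X, -(2 * R₀) ≤ p 2 ∧ p 2 ≤ h + 2 * R₀ ∧ p 0 ^ 2 + p 1 ^ 2 ≤ ρ ^ 2) →
      (∀ p, p ∈ P₁ ↔ (p ∈ (fun q => A₁ q + t₁) '' fccStacking 1 (Real.sqrt (2 / 3)) ∧
        -(2 * R₀) ≤ p 2 ∧ p 2 ≤ -R₀ ∧ p 0 ^ 2 + p 1 ^ 2 ≤ ρ ^ 2)) →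
      (∀ p, p ∈ P₂ ↔ (p ∈ (fun q => A₂ q + t₂) '' fccStacking 1 (Real.sqrt (2 / 3)) ∧
        h + R₀ ≤ p 2 ∧ p 2 ≤ h + 2 * R₀ ∧ p 0 ^ 2 + p 1 ^ 2 ≤ ρ ^ 2)) →
      ((((P₁ ×ˢ (X \ P₁)).filter fun pq => dist pq.1 pq.2 = 1).card : ℕ) : ℝ) +
        ((((P₂ ×ˢ ((X \ P₁) \ P₂)).filter fun pq => dist pq.1 pq.2 = 1).card : ℕ) : ℝ) ≤
        contactDeficiency ((X \ P₁) \ P₂) +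
          (Real.sqrt 2 / 4 * ∑ᶠ w ∈ {w ∈ fccStacking 1 (Real.sqrt (2 / 3)) | ‖w‖ = 1},
              |⟪w, A₁.symm (EuclideanSpace.single (2 : Fin 3) (1 : ℝ))⟫_ℝ| +
            Real.sqrt 2 / 4 * ∑ᶠ w ∈ {w ∈ fccStacking 1 (Real.sqrt (2 / 3)) | ‖w‖ = 1},
              |⟪w, A₂.symm (EuclideanSpace.single (2 : Fin 3) (1 : ℝ))⟫_ℝ| -
            (2 * Real.sqrt 6 / 3 : ℝ) * Real.sqrt (1 - ⟪L (EuclideanSpace.single (2 : Fin 3) (1 : ℝ)),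
              (EuclideanSpace.single (2 : Fin 3) (1 : ℝ))⟫_ℝ ^ 2)) * Real.pi * ρ ^ 2 +
          C * (1 + h) * ρ +
          1 / 2 * ∑ z ∈ X.filter (fun z => (-R₀ - 2 ≤ z 2 ∧ z 2 ≤ h + R₀ + 2) ∧
              (∃ i j c k : ℤ, z = L ((i : ℝ) • triangularVec₁ (1 : ℝ) + (j : ℝ) • triangularVec₂ (1 : ℝ) +
                (c : ℝ) • barlowOffset (1 : ℝ) + (k : ℝ) • layerNormal (Real.sqrt (2 / 3))) + s₁) ∧
              ∃ d ∈ ({L (triangularVec₁ 1), -L (triangularVec₁ 1), L (triangularVec₂ 1), -L (triangularVec₂ 1),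
                  L (triangularVec₂ 1 - triangularVec₁ 1), -L (triangularVec₂ 1 - triangularVec₁ 1)} :
                  Finset (EuclideanSpace ℝ (Fin 3))), z + d ∉ X),
            ((X.filter fun q => dist z q = 1 ∧ ¬ ∃ i j c k : ℤ, q = L ((i : ℝ) • triangularVec₁ (1 : ℝ) +
              (j : ℝ) • triangularVec₂ (1 : ℝ) + (c : ℝ) • barlowOffset (1 : ℝ) +
              (k : ℝ) • layerNormal (Real.sqrt (2 / 3))) + s₁).card : ℝ) := by
  set e₃ : EuclideanSpace ℝ (Fin 3) := EuclideanSpace.single (2 : Fin 3) (1 : ℝ) with he₃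
  set s : ℝ := Real.sqrt (1 - ⟪L e₃, e₃⟫_ℝ ^ 2) with hs
  have hs0 : 0 ≤ s := Real.sqrt_nonneg _
  obtain ⟨Cpa, hCpa⟩ := twoSlab_cross_le_of_deficit_budget A₁ t₁ A₂ t₂ 10 (by norm_num)
  set C₀ : ℝ := 6 * (12 * Real.sqrt 2 * Real.pi + 72 * 10) with hC₀
  have hC₀0 : 0 ≤ C₀ := by positivity
  -- the three signed in-plane classes as non-descending slots of grain 1
  obtain ⟨hn₁, hn₂, hn₁₂⟩ := norm_triangularVec_one
  have hv₁ : (((1 : ℤ) : ℝ)) • triangularVec₁ (1 : ℝ) + (((0 : ℤ) : ℝ)) • triangularVec₂ (1 : ℝ) =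
      triangularVec₁ 1 := by simp
  have hv₂ : (((0 : ℤ) : ℝ)) • triangularVec₁ (1 : ℝ) + (((1 : ℤ) : ℝ)) • triangularVec₂ (1 : ℝ) =
      triangularVec₂ 1 := by simp
  have hv₃ : (((-1 : ℤ) : ℝ)) • triangularVec₁ (1 : ℝ) + (((1 : ℤ) : ℝ)) • triangularVec₂ (1 : ℝ) =
      triangularVec₂ 1 - triangularVec₁ 1 := by push_cast; module
  obtain ⟨ε₁, hε₁, w₁, hw₁, hA₁, hup₁⟩ := exists_up_slot_of_inPlane_class A₁ t₁ L s₁ hσ hsub₁ 1 0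
    (by rw [hv₁]; exact hn₁)
  obtain ⟨ε₂, hε₂, w₂, hw₂, hA₂, hup₂⟩ := exists_up_slot_of_inPlane_class A₁ t₁ L s₁ hσ hsub₁ 0 1
    (by rw [hv₂]; exact hn₂)
  obtain ⟨ε₃, hε₃, w₃, hw₃, hA₃, hup₃⟩ := exists_up_slot_of_inPlane_class A₁ t₁ L s₁ hσ hsub₁ (-1) 1
    (by rw [hv₃]; exact hn₁₂)
  -- the opposite classes as non-ascending slots of grain 2
  have hε₁' : (-ε₁ = 1 ∨ -ε₁ = -1) := by rcases hε₁ with h | h <;> rw [h] <;> norm_num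
  have hε₂' : (-ε₂ = 1 ∨ -ε₂ = -1) := by rcases hε₂ with h | h <;> rw [h] <;> norm_num
  have hε₃' : (-ε₃ = 1 ∨ -ε₃ = -1) := by rcases hε₃ with h | h <;> rw [h] <;> norm_num
  obtain ⟨w₁', hw₁', hA₁'⟩ := exists_slot_top_of_inPlane_class A₂ t₂ L s₂ hσ' hsub₂ 1 0 (by rw [hv₁]; exact hn₁) hε₁'
  obtain ⟨w₂', hw₂', hA₂'⟩ := exists_slot_top_of_inPlane_class A₂ t₂ L s₂ hσ' hsub₂ 0 1 (by rw [hv₂]; exact hn₂) hε₂'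
  obtain ⟨w₃', hw₃', hA₃'⟩ := exists_slot_top_of_inPlane_class A₂ t₂ L s₂ hσ' hsub₂ (-1) 1
    (by rw [hv₃]; exact hn₁₂) hε₃'
  have hopp : ∀ {ε : ℝ} (v : EuclideanSpace ℝ (Fin 3)), L ((-ε) • v) = -L (ε • v) := by
    intro ε v; rw [neg_smul, map_neg]
  refine ⟨Cpa + C₀ / 2, 10, by norm_num, ?_⟩
  intro h hh ρ hρ X P₁ P₂ hX hP₁X hP₂X₁ hcell hP₁ hP₂
  have hP₂X : P₂ ⊆ X := hP₂X₁.trans sdiff_subset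
  have hρ0 : (0 : ℝ) ≤ ρ := by linarith
  -- balls of `Λ₂` are sites of `(L, s₁)` (compatible origins)
  have hsite₂ : ∀ e ∈ X, e ∈ (fun q => A₂ q + t₂) '' fccStacking 1 (Real.sqrt (2 / 3)) →
      ∃ i j c k : ℤ, e = L ((i : ℝ) • triangularVec₁ (1 : ℝ) + (j : ℝ) • triangularVec₂ (1 : ℝ) +
        (c : ℝ) • barlowOffset (1 : ℝ) + (k : ℝ) • layerNormal (Real.sqrt (2 / 3))) + s₁ := by
    intro e _ he
    obtain ⟨i, j, c, k, hek⟩ := site_of_mem_coaxialGrain A₂ t₂ L s₂ hsub₂ e he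
    obtain ⟨i₀, j₀, c₀, k₀, hs⟩ := hcompat
    refine ⟨i + i₀, j + j₀, c + c₀, k + k₀, ?_⟩
    have : L ((((i + i₀ : ℤ)) : ℝ) • triangularVec₁ (1 : ℝ) + (((j + j₀ : ℤ)) : ℝ) • triangularVec₂ (1 : ℝ) +
        (((c + c₀ : ℤ)) : ℝ) • barlowOffset (1 : ℝ) + (((k + k₀ : ℤ)) : ℝ) • layerNormal (Real.sqrt (2 / 3))) =
        L ((i : ℝ) • triangularVec₁ (1 : ℝ) + (j : ℝ) • triangularVec₂ (1 : ℝ) + (c : ℝ) • barlowOffset (1 : ℝ) +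
          (k : ℝ) • layerNormal (Real.sqrt (2 / 3))) +
        L ((i₀ : ℝ) • triangularVec₁ (1 : ℝ) + (j₀ : ℝ) • triangularVec₂ (1 : ℝ) + (c₀ : ℝ) • barlowOffset (1 : ℝ) +
          (k₀ : ℝ) • layerNormal (Real.sqrt (2 / 3))) := by
      rw [← map_add]; congr 1; push_cast; module
    rw [hek, hs, this]; abel
  -- the three located run-end counts
  have hE₁ := card_inPlane_runEnds_ge_coaxial A₁ t₁ A₂ t₂ L s₁ s₂ hσ hσ' hsub₁ hsub₂ hne X P₁ P₂ 10 h ρ le_rfl hρ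
    hX hcell hP₁X hP₂X hP₁ hP₂ hw₁ hup₁ hε₁ 1 0 hA₁
  have hE₂ := card_inPlane_runEnds_ge_coaxial A₁ t₁ A₂ t₂ L s₁ s₂ hσ hσ' hsub₁ hsub₂ hne X P₁ P₂ 10 h ρ le_rfl hρ
    hX hcell hP₁X hP₂X hP₁ hP₂ hw₂ hup₂ hε₂ 0 1 hA₂
  have hE₃ := card_inPlane_runEnds_ge_coaxial A₁ t₁ A₂ t₂ L s₁ s₂ hσ hσ' hsub₁ hsub₂ hne X P₁ P₂ 10 h ρ le_rfl hρ
    hX hcell hP₁X hP₂X hP₁ hP₂ hw₃ hup₃ hε₃ (-1) 1 hA₃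
  -- the three located run-end counts of the top grain (opposite directions)
  have hdn : ∀ {w w' : EuclideanSpace ℝ (Fin 3)} {ε : ℝ} (v : EuclideanSpace ℝ (Fin 3)),
      A₁ w = L (ε • v) → A₂ w' = L ((-ε) • v) → 0 ≤ ⟪A₁ w, e₃⟫_ℝ → ⟪A₂ w', e₃⟫_ℝ ≤ 0 := by
    intro w w' ε v h1 h2 h3
    rw [h2, hopp, inner_neg_left, ← h1]; linarith
  have hF₁ := card_inPlane_runEnds_top_ge_coaxial A₁ t₁ A₂ t₂ L s₁ s₂ hσ hσ' hsub₁ hsub₂ hne X P₁ P₂ 10 h ρ le_rfl hρ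
    hX hcell hP₁X hP₂X hP₁ hP₂ hw₁' (hdn _ hA₁ hA₁' hup₁) hε₁' 1 0 hA₁'
  have hF₂ := card_inPlane_runEnds_top_ge_coaxial A₁ t₁ A₂ t₂ L s₁ s₂ hσ hσ' hsub₁ hsub₂ hne X P₁ P₂ 10 h ρ le_rfl hρ
    hX hcell hP₁X hP₂X hP₁ hP₂ hw₂' (hdn _ hA₂ hA₂' hup₂) hε₂' 0 1 hA₂'
  have hF₃ := card_inPlane_runEnds_top_ge_coaxial A₁ t₁ A₂ t₂ L s₁ s₂ hσ hσ' hsub₁ hsub₂ hne X P₁ P₂ 10 h ρ le_rfl hρ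
    hX hcell hP₁X hP₂X hP₁ hP₂ hw₃' (hdn _ hA₃ hA₃' hup₃) hε₃' (-1) 1 hA₃'
  rw [hv₁] at hA₁ hA₁'
  rw [hv₂] at hA₂ hA₂'
  rw [hv₃] at hA₃ hA₃'
  -- the top grain's slot vectors are the opposites
  have ho₁ : A₂ w₁' = -A₁ w₁ := by rw [hA₁', hA₁, hopp]
  have ho₂ : A₂ w₂' = -A₁ w₂ := by rw [hA₂', hA₂, hopp]
  have ho₃ : A₂ w₃' = -A₁ w₃ := by rw [hA₃', hA₃, hopp]
  have habs' : ∀ i : Fin 3, True := fun _ => trivial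
  have hfl₁ : |⟪A₂ w₁', e₃⟫_ℝ| = |⟪A₁ w₁, e₃⟫_ℝ| := by rw [ho₁, inner_neg_left, abs_neg]
  have hfl₂ : |⟪A₂ w₂', e₃⟫_ℝ| = |⟪A₁ w₂, e₃⟫_ℝ| := by rw [ho₂, inner_neg_left, abs_neg]
  have hfl₃ : |⟪A₂ w₃', e₃⟫_ℝ| = |⟪A₁ w₃, e₃⟫_ℝ| := by rw [ho₃, inner_neg_left, abs_neg]
  rw [hfl₁, ho₁] at hF₁
  rw [hfl₂, ho₂] at hF₂
  rw [hfl₃, ho₃] at hF₃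
  -- the fluxes of the three classes carry the sine
  have habs : ∀ {ε : ℝ} (v : EuclideanSpace ℝ (Fin 3)), (ε = 1 ∨ ε = -1) →
      |⟪L (ε • v), e₃⟫_ℝ| = |⟪L v, e₃⟫_ℝ| := by
    intro ε v hε
    rcases hε with rfl | rfl
    · rw [one_smul]
    · rw [neg_one_smul, map_neg, inner_neg_left, abs_neg]
  have hflux : Real.sqrt 6 * s ≤ Real.sqrt 2 * (|⟪A₁ w₁, e₃⟫_ℝ| + |⟪A₁ w₂, e₃⟫_ℝ| + |⟪A₁ w₃, e₃⟫_ℝ|) := by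
    rw [hA₁, hA₂, hA₃, habs _ hε₁, habs _ hε₂, habs _ hε₃]
    exact coaxial_sine_le_inPlaneClasses L
  -- the window sum, its on-site part, and the local law
  set XwinAll := X.filter fun z => -(10 : ℝ) - 2 ≤ z 2 ∧ z 2 ≤ h + 10 + 2 with hXwinAll
  set SIX : Finset (EuclideanSpace ℝ (Fin 3)) := {L (triangularVec₁ 1), -L (triangularVec₁ 1),
    L (triangularVec₂ 1), -L (triangularVec₂ 1), L (triangularVec₂ 1 - triangularVec₁ 1),
    -L (triangularVec₂ 1 - triangularVec₁ 1)} with hSIX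
  set Xwin := X.filter (fun z => (-(10 : ℝ) - 2 ≤ z 2 ∧ z 2 ≤ h + 10 + 2) ∧
    (∃ i j c k : ℤ, z = L ((i : ℝ) • triangularVec₁ (1 : ℝ) + (j : ℝ) • triangularVec₂ (1 : ℝ) +
      (c : ℝ) • barlowOffset (1 : ℝ) + (k : ℝ) • layerNormal (Real.sqrt (2 / 3))) + s₁) ∧
    ∃ d ∈ SIX, z + d ∉ X) with hXwin
  set off : EuclideanSpace ℝ (Fin 3) → ℕ := fun z => (X.filter fun q => dist z q = 1 ∧ ¬ ∃ i j c k : ℤ,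
    q = L ((i : ℝ) • triangularVec₁ (1 : ℝ) + (j : ℝ) • triangularVec₂ (1 : ℝ) + (c : ℝ) • barlowOffset (1 : ℝ) +
      (k : ℝ) • layerNormal (Real.sqrt (2 / 3))) + s₁).card with hoff
  have hloc : ∀ z ∈ Xwin, ((SIX.filter fun d => z + d ∉ X).card : ℝ) ≤
      (12 : ℝ) - ((X.filter fun q => dist z q = 1).card : ℝ) + (off z : ℝ) := by
    intro z hz
    have hzsite := (mem_filter.1 hz).2.2.1
    have h := onSite_card_contacts_add_vacant_le L s₁ X hX hzsite
    have h' : (((X.filter fun q => dist z q = 1).card : ℕ) : ℝ) +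
        (((SIX.filter fun d => z + d ∉ X).card : ℕ) : ℝ) ≤ 12 + (off z : ℝ) := by
      rw [hoff]; exact_mod_cast h
    linarith
  -- swap the double count
  have hswap : ∑ z ∈ Xwin, (SIX.filter fun d => z + d ∉ X).card =
      ∑ d ∈ SIX, (Xwin.filter fun z => z + d ∉ X).card := by
    rw [Finset.sum_congr rfl (fun z _ => Finset.card_filter (fun d => z + d ∉ X) SIX), Finset.sum_comm]
    refine sum_congr rfl fun d _ => ?_
    rw [Finset.card_filter]
  -- the three classes inside the six, pairwise distinct
  have hmem : ∀ {ε : ℝ} (v : EuclideanSpace ℝ (Fin 3)), (ε = 1 ∨ ε = -1) → (L v ∈ SIX ∧ -L v ∈ SIX) →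
      L (ε • v) ∈ SIX := by
    intro ε v hε hv
    rcases hε with rfl | rfl
    · rw [one_smul]; exact hv.1
    · rw [neg_one_smul, map_neg]; exact hv.2
  have hd₁m : A₁ w₁ ∈ SIX := by rw [hA₁]; exact hmem _ hε₁ (by simp [hSIX])
  have hd₂m : A₁ w₂ ∈ SIX := by rw [hA₂]; exact hmem _ hε₂ (by simp [hSIX])
  have hd₃m : A₁ w₃ ∈ SIX := by rw [hA₃]; exact hmem _ hε₃ (by simp [hSIX])
  obtain ⟨h12, -, -⟩ := inPlane_classes_ne hε₁ hε₂
  obtain ⟨-, h13, -⟩ := inPlane_classes_ne hε₁ hε₃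
  obtain ⟨-, -, h23⟩ := inPlane_classes_ne hε₂ hε₃
  have hne12 : A₁ w₁ ≠ A₁ w₂ := by rw [hA₁, hA₂]; exact fun h => h12 (L.injective h)
  have hne13 : A₁ w₁ ≠ A₁ w₃ := by rw [hA₁, hA₃]; exact fun h => h13 (L.injective h)
  have hne23 : A₁ w₂ ≠ A₁ w₃ := by rw [hA₂, hA₃]; exact fun h => h23 (L.injective h)
  -- the opposites: in the six, and the six signed classes are pairwise distinct
  have hnegSIX : ∀ d ∈ SIX, -d ∈ SIX := by
    intro d hd
    simp only [hSIX, mem_insert, mem_singleton] at hd ⊢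
    rcases hd with rfl | rfl | rfl | rfl | rfl | rfl <;> simp
  have hn₁m : -A₁ w₁ ∈ SIX := hnegSIX _ hd₁m
  have hn₂m : -A₁ w₂ ∈ SIX := hnegSIX _ hd₂m
  have hn₃m : -A₁ w₃ ∈ SIX := hnegSIX _ hd₃m
  have hself : ∀ {w : EuclideanSpace ℝ (Fin 3)}, w ∈ fccSlots → A₁ w ≠ -A₁ w := by
    intro w hw h0
    have h2 : (2 : ℝ) • A₁ w = 0 := by rw [two_smul]; nth_rewrite 2 [h0]; exact add_neg_cancel _
    have : A₁ w = 0 := by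
      rcases smul_eq_zero.1 h2 with h | h
      · norm_num at h
      · exact h
    have hn := norm_eq_one_of_mem_fccSlots hw
    rw [← LinearIsometryEquiv.norm_map A₁, this, norm_zero] at hn
    norm_num at hn
  obtain ⟨h12n, -, -⟩ := inPlane_classes_ne hε₁ hε₂'
  obtain ⟨-, h13n, -⟩ := inPlane_classes_ne hε₁ hε₃'
  obtain ⟨-, -, h23n⟩ := inPlane_classes_ne hε₂ hε₃'
  obtain ⟨h21n, -, -⟩ := inPlane_classes_ne hε₁' hε₂
  obtain ⟨-, h31n, -⟩ := inPlane_classes_ne hε₁' hε₃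
  obtain ⟨-, -, h32n⟩ := inPlane_classes_ne hε₂' hε₃
  have hx12 : A₁ w₁ ≠ -A₁ w₂ := by rw [hA₁, hA₂, ← hopp]; exact fun h => h12n (L.injective h)
  have hx13 : A₁ w₁ ≠ -A₁ w₃ := by rw [hA₁, hA₃, ← hopp]; exact fun h => h13n (L.injective h)
  have hx23 : A₁ w₂ ≠ -A₁ w₃ := by rw [hA₂, hA₃, ← hopp]; exact fun h => h23n (L.injective h)
  have hx21 : -A₁ w₁ ≠ A₁ w₂ := by rw [hA₁, hA₂, ← hopp]; exact fun h => h21n (L.injective h)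
  have hx31 : -A₁ w₁ ≠ A₁ w₃ := by rw [hA₁, hA₃, ← hopp]; exact fun h => h31n (L.injective h)
  have hx32 : -A₁ w₂ ≠ A₁ w₃ := by rw [hA₂, hA₃, ← hopp]; exact fun h => h32n (L.injective h)
  have hs₁ := hself hw₁
  have hs₂ := hself hw₂
  have hs₃ := hself hw₃
  have hn12 : -A₁ w₁ ≠ -A₁ w₂ := fun h => hne12 (neg_injective h)
  have hn13 : -A₁ w₁ ≠ -A₁ w₃ := fun h => hne13 (neg_injective h)
  have hn23 : -A₁ w₂ ≠ -A₁ w₃ := fun h => hne23 (neg_injective h)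
  have hsub3 : ({A₁ w₁, A₁ w₂, A₁ w₃, -A₁ w₁, -A₁ w₂, -A₁ w₃} : Finset (EuclideanSpace ℝ (Fin 3))) ⊆ SIX := by
    intro d hd
    simp only [mem_insert, mem_singleton] at hd
    rcases hd with rfl | rfl | rfl | rfl | rfl | rfl
    · exact hd₁m
    · exact hd₂m
    · exact hd₃m
    · exact hn₁m
    · exact hn₂m
    · exact hn₃m
  have hthree : ∑ d ∈ ({A₁ w₁, A₁ w₂, A₁ w₃, -A₁ w₁, -A₁ w₂, -A₁ w₃} : Finset (EuclideanSpace ℝ (Fin 3))),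
      (Xwin.filter fun z => z + d ∉ X).card =
      (Xwin.filter fun z => z + A₁ w₁ ∉ X).card + (Xwin.filter fun z => z + A₁ w₂ ∉ X).card +
        (Xwin.filter fun z => z + A₁ w₃ ∉ X).card + (Xwin.filter fun z => z + -A₁ w₁ ∉ X).card +
        (Xwin.filter fun z => z + -A₁ w₂ ∉ X).card + (Xwin.filter fun z => z + -A₁ w₃ ∉ X).card := by
    rw [sum_insert (by simp [hne12, hne13, hs₁, hx12, hx13]),
      sum_insert (by simp [hne23, hx21.symm, hs₂, hx23]),
      sum_insert (by simp [hx31.symm, hx32.symm, hs₃]),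
      sum_insert (by simp [hn12, hn13]), sum_insert (by simp [hn23]), sum_singleton]
    ring
  have hsub_sum : ∑ d ∈ ({A₁ w₁, A₁ w₂, A₁ w₃, -A₁ w₁, -A₁ w₂, -A₁ w₃} : Finset (EuclideanSpace ℝ (Fin 3))),
      (Xwin.filter fun z => z + d ∉ X).card ≤ ∑ d ∈ SIX, (Xwin.filter fun z => z + d ∉ X).card :=
    sum_le_sum_of_subset_of_nonneg hsub3 (fun _ _ _ => Nat.zero_le _)
  -- located ends (of either grain) are on-site window balls with a vacant in-plane site
  have hsite₁ := site_of_mem_coaxialGrain A₁ t₁ L s₁ hsub₁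
  have hEsub : ∀ d ∈ SIX,
      (X.filter fun e => e ∈ (fun q => A₁ q + t₁) '' fccStacking 1 (Real.sqrt (2 / 3)) ∧
        e ∉ (fun q => A₂ q + t₂) '' fccStacking 1 (Real.sqrt (2 / 3)) ∧ e + d ∉ X ∧
        -(10 : ℝ) - 2 ≤ e 2 ∧ e 2 ≤ h + 10 + 2).card ≤ (Xwin.filter fun z => z + d ∉ X).card := by
    intro d hd
    refine card_le_card ?_
    intro e he
    rw [mem_filter] at he
    rw [mem_filter, hXwin, mem_filter]
    exact ⟨⟨he.1, ⟨he.2.2.2.2.1, he.2.2.2.2.2⟩, hsite₁ e he.2.1, d, hd, he.2.2.2.1⟩, he.2.2.2.1⟩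
  have hEsub' : ∀ d ∈ SIX,
      (X.filter fun e => e ∈ (fun q => A₂ q + t₂) '' fccStacking 1 (Real.sqrt (2 / 3)) ∧
        e ∉ (fun q => A₁ q + t₁) '' fccStacking 1 (Real.sqrt (2 / 3)) ∧ e + d ∉ X ∧
        -(10 : ℝ) - 2 ≤ e 2 ∧ e 2 ≤ h + 10 + 2).card ≤ (Xwin.filter fun z => z + d ∉ X).card := by
    intro d hd
    refine card_le_card ?_
    intro e he
    rw [mem_filter] at he
    rw [mem_filter, hXwin, mem_filter]
    exact ⟨⟨he.1, ⟨he.2.2.2.2.1, he.2.2.2.2.2⟩, hsite₂ e he.1 he.2.1, d, hd, he.2.2.2.1⟩, he.2.2.2.1⟩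
  -- assemble the payer bound
  set S : ℝ := ∑ z ∈ XwinAll, ((12 : ℝ) - ((X.filter fun q => dist z q = 1).card : ℝ)) with hS
  set B : ℝ := ∑ z ∈ Xwin, (off z : ℝ) with hB
  have hSsub : ∑ z ∈ Xwin, ((12 : ℝ) - ((X.filter fun q => dist z q = 1).card : ℝ)) ≤ S := by
    refine sum_le_sum_of_subset_of_nonneg ?_ ?_
    · intro z hz
      rw [hXwin, mem_filter] at hz
      rw [hXwinAll, mem_filter]
      exact ⟨hz.1, hz.2.1⟩
    · intro z hz _
      have := card_filter_dist_eq_one_le_twelve X hX z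
      have h' : (((X.filter fun q => dist z q = 1).card : ℕ) : ℝ) ≤ 12 := by exact_mod_cast this
      linarith
  have hS_ge : (((Xwin.filter fun z => z + A₁ w₁ ∉ X).card : ℕ) : ℝ) +
      (((Xwin.filter fun z => z + A₁ w₂ ∉ X).card : ℕ) : ℝ) +
      (((Xwin.filter fun z => z + A₁ w₃ ∉ X).card : ℕ) : ℝ) +
      (((Xwin.filter fun z => z + -A₁ w₁ ∉ X).card : ℕ) : ℝ) +
      (((Xwin.filter fun z => z + -A₁ w₂ ∉ X).card : ℕ) : ℝ) +
      (((Xwin.filter fun z => z + -A₁ w₃ ∉ X).card : ℕ) : ℝ) - B ≤ S := by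
    have h1 : (∑ z ∈ Xwin, ((SIX.filter fun d => z + d ∉ X).card : ℝ)) ≤
        ∑ z ∈ Xwin, (((12 : ℝ) - ((X.filter fun q => dist z q = 1).card : ℝ)) + (off z : ℝ)) :=
      sum_le_sum hloc
    rw [sum_add_distrib] at h1
    have h2 : ((∑ d ∈ ({A₁ w₁, A₁ w₂, A₁ w₃, -A₁ w₁, -A₁ w₂, -A₁ w₃} : Finset (EuclideanSpace ℝ (Fin 3))),
        (Xwin.filter fun z => z + d ∉ X).card : ℕ) : ℝ) ≤
        ((∑ d ∈ SIX, (Xwin.filter fun z => z + d ∉ X).card : ℕ) : ℝ) := by exact_mod_cast hsub_sum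
    rw [hthree] at h2
    rw [← hswap] at h2
    push_cast at h1 h2
    linarith [hSsub]
  have hE₁' := hE₁.trans (Nat.cast_le.2 (hEsub (A₁ w₁) hd₁m))
  have hE₂' := hE₂.trans (Nat.cast_le.2 (hEsub (A₁ w₂) hd₂m))
  have hE₃' := hE₃.trans (Nat.cast_le.2 (hEsub (A₁ w₃) hd₃m))
  have hF₁' := hF₁.trans (Nat.cast_le.2 (hEsub' (-A₁ w₁) hn₁m))
  have hF₂' := hF₂.trans (Nat.cast_le.2 (hEsub' (-A₁ w₂) hn₂m))
  have hF₃' := hF₃.trans (Nat.cast_le.2 (hEsub' (-A₁ w₃) hn₃m))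
  have hpay : (4 / 3 * Real.sqrt 6 * s) * Real.pi * ρ ^ 2 - C₀ * (1 + h) * ρ - B ≤ S := by
    set a₁ := |⟪A₁ w₁, e₃⟫_ℝ| with ha₁
    set a₂ := |⟪A₁ w₂, e₃⟫_ℝ| with ha₂
    set a₃ := |⟪A₁ w₃, e₃⟫_ℝ| with ha₃
    set Q : ℝ := Real.sqrt 2 * Real.pi * ρ ^ 2 with hQ
    have hQ0 : 0 ≤ Q := by positivity
    have e₁ : 2 / 3 * Real.sqrt 2 * a₁ * Real.pi * ρ ^ 2 = 2 / 3 * a₁ * Q := by rw [hQ]; ring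
    have e₂ : 2 / 3 * Real.sqrt 2 * a₂ * Real.pi * ρ ^ 2 = 2 / 3 * a₂ * Q := by rw [hQ]; ring
    have e₃' : 2 / 3 * Real.sqrt 2 * a₃ * Real.pi * ρ ^ 2 = 2 / 3 * a₃ * Q := by rw [hQ]; ring
    rw [e₁] at hE₁' hF₁'
    rw [e₂] at hE₂' hF₂'
    rw [e₃'] at hE₃' hF₃'
    have hsum : 4 / 3 * (a₁ + a₂ + a₃) * Q - C₀ * ρ - B ≤ S := by
      have eC : C₀ * ρ = 6 * ((12 * Real.sqrt 2 * Real.pi + 72 * 10) * ρ) := by rw [hC₀]; ring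
      rw [eC]
      linarith only [hE₁', hE₂', hE₃', hF₁', hF₂', hF₃', hS_ge]
    have h1 : Real.sqrt 6 * s * (Real.pi * ρ ^ 2) ≤ (a₁ + a₂ + a₃) * Q := by
      have := mul_le_mul_of_nonneg_right hflux (show (0 : ℝ) ≤ Real.pi * ρ ^ 2 by positivity)
      have eQ : Real.sqrt 2 * (a₁ + a₂ + a₃) * (Real.pi * ρ ^ 2) = (a₁ + a₂ + a₃) * Q := by rw [hQ]; ring
      linarith [eQ]
    have h2 : C₀ * ρ ≤ C₀ * (1 + h) * ρ := by
      have : 0 ≤ C₀ * h * ρ := by positivity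
      linarith [show C₀ * (1 + h) * ρ = C₀ * ρ + C₀ * h * ρ by ring]
    have e4 : (4 / 3 * Real.sqrt 6 * s) * Real.pi * ρ ^ 2 = 4 / 3 * (Real.sqrt 6 * s * (Real.pi * ρ ^ 2)) := by ring
    rw [e4]
    linarith only [h1, h2, hsum]
  -- the payer assembly with budget `B`
  have hfin := hCpa h hh ρ hρ X P₁ P₂ hX hP₁X hP₂X₁ hcell hP₁ hP₂ (4 / 3 * Real.sqrt 6 * s) C₀ B hC₀0 hpay
  have e63 : 4 / 3 * Real.sqrt 6 * s / 2 = 2 * Real.sqrt 6 / 3 * s := by ring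
  rw [e63] at hfin
  have eB : B / 2 = 1 / 2 * B := by ring
  linarith only [hfin, eB]

end Summit.Ventures.Crystal3D.Theorems

end
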